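import Summits.QuantumFields.YangMills.Theorems.F4SubCurvatureDoorHexagonRealRootedO2
import Summits.QuantumFields.YangMills.Theorems.RationalShortRootRigidityRootsClosedLimit
import Summits.QuantumFields.YangMills.Theorems.RationalShortRootRigidityNoU3Rescaling
import Mathlib
import HarnessLib

/-!
# Hexagon normal form — no POLYNOMIAL pair passes the hexagon Wick test (rescaling principle; case `deg F < deg G + 3`)

Support lemmas toward the OPEN finite-type hexagon conjecture behind crux `stmt-QuantumFields-23125`
(`F4SubCurvatureDoor.RationalToGeneral`; definitions `P`, `WickHexagon` of `F4SubCurvatureDoorHexagonNormalFormDefs.lean`, p660858).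
The owner's CHEAPEST FALSIFIER for the hexagon line is «a finite-type shell function passing the hexagon Wick test»; this file starts
the proof that no POLYNOMIAL pair `(F, G)` with `G ≠ 0` passes it, by the RESCALING PRINCIPLE:

* `rescaled_roots_mem` — if real polynomials `Φ_n` of constant degree `k` have all their roots `z` with `c_n z ∈ S` (`S` closed) and
  the rescaled coefficients `e_n Φ_n,i c_n^{k−i}` converge to those of `q ≠ 0` of degree `k`, then every complex root of `q` lies in
  `S` (`rootsInClosedSetLimit`, p666193, applied to `e_n · scaleRoots Φ_n c_n`);
* `hexagonPencil_noPoly_lt` — CASE `deg F < deg G + 3`: with `Φ_n = F + P_{n+1} G`, `c_n = 1/(n+1)`, the limit is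
  `lc(G) w^g (w³ − 18w² + 48w − 32)`, whose root `w = 2` violates `Re w ≤ 1` — so `WickHexagon F G` fails for every such
  polynomial pair with `G ≠ 0`.

(The cases `deg F = deg G + 3` — hexagon cubic lemma / the double root `4/3` — and `deg F > deg G + 3` — scaling `z ∼ s^{3/(f−g)}`,
a non-real root of `lc(F) w^{f−g} − 32 lc(G)` — follow the same principle and are left to the next files.)

Mathlib + tree helpers only; THEOREMS ONLY; no `sorry`; default heartbeats.  Nothing about crux 23125, crux 23035, any LADDER-YM
rung or the Yang–Mills mass gap is proved here.  Free-hands seat `ym-line-frs-p2` g10, `--supports stmt-QuantumFields-23125`.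
-/

set_option autoImplicit false

open Filter Topology Polynomial

namespace Summit.QuantumFields.YangMills.Cruxes.RationalToGeneral.HexagonNormalForm

/-- **Rescaling principle.**  Real polynomials `Φ_n` of constant degree `k` whose roots `z` all satisfy `c_n z ∈ S` (`S ⊂ ℂ` closed,
`c_n ≠ 0`), with rescaled coefficients `e_n Φ_{n,i} c_n^{k−i} → q_i` (`e_n ≠ 0`) for a real `q ≠ 0` of degree `k`: every complex root
of `q` lies in `S`. [folklore] -/
theorem rescaled_roots_mem (Φ : ℕ → ℝ[X]) (k : ℕ) (hdeg : ∀ n, (Φ n).natDegree = k)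
    (c e : ℕ → ℝ) (hc : ∀ n, c n ≠ 0) (he : ∀ n, e n ≠ 0)
    (S : Set ℂ) (hS : IsClosed S)
    (hroots : ∀ (n : ℕ) (z : ℂ), Polynomial.aeval z (Φ n) = 0 → ((c n : ℂ) * z) ∈ S)
    (q : ℝ[X]) (hqdeg : q.natDegree = k) (hq0 : q ≠ 0)
    (hcoef : ∀ i : ℕ, Tendsto (fun n => e n * ((Φ n).coeff i * (c n) ^ (k - i))) atTop (𝓝 (q.coeff i))) :
    ∀ w : ℂ, Polynomial.aeval w q = 0 → w ∈ S := by
  have hinj : Function.Injective (algebraMap ℝ ℂ) := (algebraMap ℝ ℂ).injective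
  set p : ℕ → ℂ[X] := fun n => (Polynomial.C (e n) * scaleRoots (Φ n) (c n)).map (algebraMap ℝ ℂ) with hp
  set qC : ℂ[X] := q.map (algebraMap ℝ ℂ) with hqC
  have hpdeg : ∀ n, (p n).natDegree = k := by
    intro n
    rw [hp]; simp only []
    rw [natDegree_map_eq_of_injective hinj, natDegree_C_mul (he n), natDegree_scaleRoots, hdeg]
  have hqCdeg : qC.natDegree = k := by rw [hqC, natDegree_map_eq_of_injective hinj, hqdeg]
  have hqC0 : qC ≠ 0 := by rw [hqC]; exact (Polynomial.map_ne_zero_iff hinj).2 hq0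
  have hcoefC : ∀ i : ℕ, Tendsto (fun n => (p n).coeff i) atTop (𝓝 (qC.coeff i)) := by
    intro i
    have h1 : ∀ n, (p n).coeff i = ((e n * ((Φ n).coeff i * (c n) ^ (k - i)) : ℝ) : ℂ) := by
      intro n
      rw [hp]; simp only []
      rw [coeff_map, coeff_C_mul, coeff_scaleRoots, hdeg]; rfl
    have h2 : qC.coeff i = ((q.coeff i : ℝ) : ℂ) := by rw [hqC, coeff_map]; rfl
    simp_rw [h1, h2]
    exact (Complex.continuous_ofReal.tendsto _).comp (hcoef i)
  have hproots : ∀ n, ∀ w : ℂ, (p n).IsRoot w → w ∈ S := by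
    intro n w hw
    have hcC : (c n : ℂ) ≠ 0 := Complex.ofReal_ne_zero.2 (hc n)
    have h1 : Polynomial.eval₂ (algebraMap ℝ ℂ) w (scaleRoots (Φ n) (c n)) = 0 := by
      have h := hw.eq_zero
      rw [hp] at h; simp only [] at h
      rw [eval_map, Polynomial.eval₂_mul, Polynomial.eval₂_C, mul_eq_zero] at h
      rcases h with h | h
      · exact absurd h (by rw [Complex.coe_algebraMap]; exact Complex.ofReal_ne_zero.2 (he n))
      · exact h
    have h2 : w = (algebraMap ℝ ℂ) (c n) * (w / (c n : ℂ)) := by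
      rw [Complex.coe_algebraMap]; field_simp
    rw [h2, scaleRoots_eval₂_mul, mul_eq_zero] at h1
    rcases h1 with h1 | h1
    · exact absurd h1 (pow_ne_zero _ (by rw [Complex.coe_algebraMap]; exact hcC))
    · have h3 : Polynomial.aeval (w / (c n : ℂ)) (Φ n) = 0 := by rw [Polynomial.aeval_def]; exact h1
      have h4 := hroots n _ h3
      rwa [mul_div_cancel₀ _ hcC] at h4
  intro w hw
  have hwC : qC.IsRoot w := by rw [IsRoot.def, hqC, eval_map, ← Polynomial.aeval_def]; exact hw
  exact Summit.QuantumFields.YangMills.Theorems.RationalShortRootRigidity.rootsInClosedSetLimit S hS k p qC hpdeg hqCdeg hqC0 hcoefC hproots w hwC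

/-- The hexagon pencil as real polynomials: `Φ_s = F + P_s·G` evaluates to `F(z) + P_s(z) G(z)`. -/
theorem aeval_pencil (F G : ℝ[X]) (s : ℝ) (z : ℂ) :
    Polynomial.aeval z (F + (X ^ 3 - Polynomial.C (18 * s) * X ^ 2 + Polynomial.C (48 * s ^ 2) * X -
      Polynomial.C (32 * s ^ 3)) * G) = Polynomial.aeval z F + P s z * Polynomial.aeval z G := by
  rw [P_expand]
  simp only [map_add, map_mul, map_sub, map_pow, Polynomial.aeval_X, Polynomial.aeval_C, Complex.coe_algebraMap]
  push_cast
  ring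

/-- Coefficients of the hexagon pencil. -/
theorem coeff_pencil (F G : ℝ[X]) (s : ℝ) (i : ℕ) :
    (F + (X ^ 3 - Polynomial.C (18 * s) * X ^ 2 + Polynomial.C (48 * s ^ 2) * X - Polynomial.C (32 * s ^ 3)) * G).coeff i =
      F.coeff i + (X ^ 3 * G).coeff i - 18 * s * (X ^ 2 * G).coeff i + 48 * s ^ 2 * (X * G).coeff i -
        32 * s ^ 3 * G.coeff i := by
  have h : (X ^ 3 - Polynomial.C (18 * s) * X ^ 2 + Polynomial.C (48 * s ^ 2) * X - Polynomial.C (32 * s ^ 3)) * G =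
      X ^ 3 * G - Polynomial.C (18 * s) * (X ^ 2 * G) + Polynomial.C (48 * s ^ 2) * (X * G) - Polynomial.C (32 * s ^ 3) * G := by
    ring
  rw [h, coeff_add, coeff_sub, coeff_add, coeff_sub, coeff_C_mul, coeff_C_mul, coeff_C_mul]
  ring

/-- The cubic multiplier is monic of degree `3`: `deg (P_s · G) = deg G + 3`. -/
theorem natDegree_pencilMul (G : ℝ[X]) (hG : G ≠ 0) (s : ℝ) :
    ((X ^ 3 - Polynomial.C (18 * s) * X ^ 2 + Polynomial.C (48 * s ^ 2) * X - Polynomial.C (32 * s ^ 3)) * G).natDegree =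
      G.natDegree + 3 := by
  have hmon : (X ^ 3 - Polynomial.C (18 * s) * X ^ 2 + Polynomial.C (48 * s ^ 2) * X - Polynomial.C (32 * s ^ 3) : ℝ[X]).Monic := by
    have h1 : (X ^ 3 - Polynomial.C (18 * s) * X ^ 2 + Polynomial.C (48 * s ^ 2) * X - Polynomial.C (32 * s ^ 3) : ℝ[X]) =
        X ^ 3 - (Polynomial.C (18 * s) * X ^ 2 - Polynomial.C (48 * s ^ 2) * X + Polynomial.C (32 * s ^ 3)) := by ring
    rw [h1]
    refine (monic_X_pow 3).sub_of_left ?_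
    rw [degree_X_pow]
    refine (degree_add_le _ _).trans_lt (max_lt ((degree_sub_le _ _).trans_lt (max_lt ?_ ?_)) ?_)
    · exact (degree_C_mul_X_pow_le 2 _).trans_lt (by exact_mod_cast (by norm_num : (2 : ℕ) < 3))
    · exact (degree_C_mul_X_le _).trans_lt (by exact_mod_cast (by norm_num : (1 : ℕ) < 3))
    · exact degree_C_le.trans_lt (by exact_mod_cast (by norm_num : (0 : ℕ) < 3))
  have hdeg3 : (X ^ 3 - Polynomial.C (18 * s) * X ^ 2 + Polynomial.C (48 * s ^ 2) * X - Polynomial.C (32 * s ^ 3) : ℝ[X]).natDegree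
      = 3 := by
    have h1 : (X ^ 3 - Polynomial.C (18 * s) * X ^ 2 + Polynomial.C (48 * s ^ 2) * X - Polynomial.C (32 * s ^ 3) : ℝ[X]) =
        X ^ 3 - (Polynomial.C (18 * s) * X ^ 2 - Polynomial.C (48 * s ^ 2) * X + Polynomial.C (32 * s ^ 3)) := by ring
    have h2 : (Polynomial.C (18 * s) * X ^ 2 - Polynomial.C (48 * s ^ 2) * X + Polynomial.C (32 * s ^ 3) : ℝ[X]).natDegree ≤ 2 :=
      (natDegree_add_le _ _).trans (max_le ((natDegree_sub_le _ _).trans (max_le (natDegree_C_mul_X_pow_le _ _)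
        ((natDegree_C_mul_le _ _).trans (natDegree_X_le.trans (by norm_num))))) ((natDegree_C _).le.trans (by norm_num)))
    rw [h1, natDegree_sub_eq_left_of_natDegree_lt, natDegree_X_pow]
    rw [natDegree_X_pow]; omega
  rw [hmon.natDegree_mul' hG, hdeg3, add_comm]

/-- Rescaled monomial terms: `a t^u t^{-v} → 0` for `u < v` (`t = n + 1`). -/
theorem term_tendsto_zero (a : ℝ) (u v : ℕ) (h : u < v) :
    Tendsto (fun n : ℕ => a * ((n : ℝ) + 1) ^ u * (((n : ℝ) + 1)⁻¹) ^ v) atTop (𝓝 0) := by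
  have h1 : ∀ n : ℕ, a * ((n : ℝ) + 1) ^ u * (((n : ℝ) + 1)⁻¹) ^ v = a * (((n : ℝ) + 1)⁻¹) ^ (v - u) := by
    intro n
    have hn : ((n : ℝ) + 1) ≠ 0 := by positivity
    obtain ⟨d, rfl⟩ : ∃ d, v = u + d := ⟨v - u, by omega⟩
    rw [Nat.add_sub_cancel_left, pow_add, mul_assoc, ← mul_assoc (((n : ℝ) + 1) ^ u), ← mul_pow,
      mul_inv_cancel₀ hn, one_pow, one_mul]
  simp_rw [h1]
  have h2 := (Summit.QuantumFields.YangMills.Theorems.RationalShortRootRigidity.tendsto_inv_succ_pow (v - u)).const_mul a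
  rw [if_neg (by omega), mul_zero] at h2
  exact h2

/-- Rescaled monomial terms: `a t^u t^{-u} = a`. -/
theorem term_eq (a : ℝ) (u : ℕ) (n : ℕ) : a * ((n : ℝ) + 1) ^ u * (((n : ℝ) + 1)⁻¹) ^ u = a := by
  have hn : ((n : ℝ) + 1) ≠ 0 := by positivity
  rw [mul_assoc, ← mul_pow, mul_inv_cancel₀ hn, one_pow, mul_one]

/-- **No polynomial pair passes the hexagon Wick test, case `deg F < deg G + 3`.**  For real polynomials `F`, `G ≠ 0` with
`deg F < deg G + 3`, `WickHexagon F G` fails: rescaling `z = (n+1) w`, `s = n + 1` the pencil tends to `lc(G) w^g (w³ − 18w² + 48w − 32)`,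
which has the root `w = 2` outside the closed set `{Im w = 0, Re w ≤ 1}` containing all rescaled roots. [folklore] -/
theorem hexagonPencil_noPoly_lt (F G : ℝ[X]) (hG : G ≠ 0) (hlt : F.natDegree < G.natDegree + 3)
    (hW : WickHexagon (fun z => Polynomial.aeval z F) (fun z => Polynomial.aeval z G)) : False := by
  classical
  set g := G.natDegree with hg
  have hlc : G.leadingCoeff ≠ 0 := leadingCoeff_ne_zero.2 hG
  -- the pencil along `s = n + 1`
  set Φ : ℕ → ℝ[X] := fun n => F + (X ^ 3 - Polynomial.C (18 * ((n : ℝ) + 1)) * X ^ 2 +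
    Polynomial.C (48 * ((n : ℝ) + 1) ^ 2) * X - Polynomial.C (32 * ((n : ℝ) + 1) ^ 3)) * G with hΦ
  have hdeg : ∀ n, (Φ n).natDegree = g + 3 := by
    intro n
    rw [hΦ]; simp only []
    rw [natDegree_add_eq_right_of_natDegree_lt, natDegree_pencilMul G hG]
    rw [natDegree_pencilMul G hG]; exact hlt
  -- the limit polynomial
  set q : ℝ[X] := Polynomial.C G.leadingCoeff * X ^ g * (X ^ 3 - Polynomial.C 18 * X ^ 2 + Polynomial.C 48 * X - Polynomial.C 32)
    with hq
  have hq' : q = Polynomial.C G.leadingCoeff * X ^ (g + 3) - Polynomial.C (18 * G.leadingCoeff) * X ^ (g + 2) +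
      Polynomial.C (48 * G.leadingCoeff) * X ^ (g + 1) - Polynomial.C (32 * G.leadingCoeff) * X ^ g := by
    rw [hq]; simp only [map_mul]; ring
  have hqcoeff : ∀ i, q.coeff i = (if i = g + 3 then G.leadingCoeff else 0) - (if i = g + 2 then 18 * G.leadingCoeff else 0) +
      (if i = g + 1 then 48 * G.leadingCoeff else 0) - (if i = g then 32 * G.leadingCoeff else 0) := by
    intro i
    rw [hq', coeff_sub, coeff_add, coeff_sub, coeff_C_mul_X_pow, coeff_C_mul_X_pow, coeff_C_mul_X_pow, coeff_C_mul_X_pow]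
  have hqdeg : q.natDegree = g + 3 := by
    refine le_antisymm ?_ (le_natDegree_of_ne_zero ?_)
    · rw [hq']
      refine (natDegree_sub_le _ _).trans (max_le ((natDegree_add_le _ _).trans (max_le ((natDegree_sub_le _ _).trans (max_le
        (natDegree_C_mul_X_pow_le _ _) ((natDegree_C_mul_X_pow_le _ _).trans (by omega))))
        ((natDegree_C_mul_X_pow_le _ _).trans (by omega)))) ((natDegree_C_mul_X_pow_le _ _).trans (by omega)))
    · rw [hqcoeff, if_pos rfl, if_neg (by omega), if_neg (by omega), if_neg (by omega)]
      simp only [sub_zero, add_zero]; exact hlc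
  have hq0 : q ≠ 0 := by
    intro h; have := hqcoeff (g + 3)
    rw [h, coeff_zero, if_pos rfl, if_neg (by omega), if_neg (by omega), if_neg (by omega)] at this
    simp only [sub_zero, add_zero] at this; exact hlc this.symm
  -- the closed set of admissible rescaled roots
  have hS : IsClosed {w : ℂ | w.im = 0 ∧ w.re ≤ 1} :=
    (isClosed_eq Complex.continuous_im continuous_const).inter (isClosed_le Complex.continuous_re continuous_const)
  have hroots : ∀ (n : ℕ) (z : ℂ), Polynomial.aeval z (Φ n) = 0 →
      (((((n : ℝ) + 1)⁻¹ : ℝ) : ℂ) * z) ∈ {w : ℂ | w.im = 0 ∧ w.re ≤ 1} := by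
    intro n z hz
    rw [hΦ] at hz; simp only [] at hz
    rw [aeval_pencil] at hz
    have hn : (0 : ℝ) < (n : ℝ) + 1 := by positivity
    obtain ⟨him, hre⟩ := hW ((n : ℝ) + 1) hn.le z hz
    refine ⟨by rw [Complex.mul_im, Complex.ofReal_re, Complex.ofReal_im, him]; ring, ?_⟩
    rw [Complex.mul_re, Complex.ofReal_re, Complex.ofReal_im, him, mul_zero, sub_zero]
    rw [inv_mul_le_iff₀ hn]; linarith
  -- coefficient convergence
  have hcoef : ∀ i : ℕ, Tendsto (fun n => (1 : ℝ) * ((Φ n).coeff i * (((n : ℝ) + 1)⁻¹) ^ (g + 3 - i))) atTop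
      (𝓝 (q.coeff i)) := by
    intro i
    have hform : ∀ n : ℕ, (1 : ℝ) * ((Φ n).coeff i * (((n : ℝ) + 1)⁻¹) ^ (g + 3 - i)) =
        F.coeff i * ((n : ℝ) + 1) ^ 0 * (((n : ℝ) + 1)⁻¹) ^ (g + 3 - i) +
        (X ^ 3 * G).coeff i * ((n : ℝ) + 1) ^ 0 * (((n : ℝ) + 1)⁻¹) ^ (g + 3 - i) -
        18 * (X ^ 2 * G).coeff i * ((n : ℝ) + 1) ^ 1 * (((n : ℝ) + 1)⁻¹) ^ (g + 3 - i) +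
        48 * (X * G).coeff i * ((n : ℝ) + 1) ^ 2 * (((n : ℝ) + 1)⁻¹) ^ (g + 3 - i) -
        32 * G.coeff i * ((n : ℝ) + 1) ^ 3 * (((n : ℝ) + 1)⁻¹) ^ (g + 3 - i) := by
      intro n; rw [hΦ]; simp only []; rw [coeff_pencil]; ring
    simp_rw [hform]
    have hXk : ∀ k : ℕ, (X ^ k * G).coeff i = if k ≤ i then G.coeff (i - k) else 0 := fun k => by
      rw [coeff_X_pow_mul']
    have hlcg : G.coeff g = G.leadingCoeff := rfl
    -- `F_i t^{-(g+3-i)} → 0`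
    have hA : Tendsto (fun n : ℕ => F.coeff i * ((n : ℝ) + 1) ^ 0 * (((n : ℝ) + 1)⁻¹) ^ (g + 3 - i)) atTop (𝓝 0) := by
      by_cases hFi : F.coeff i = 0
      · simp only [hFi, zero_mul]; exact tendsto_const_nhds
      · have hi : i ≤ F.natDegree := le_natDegree_of_ne_zero hFi
        exact term_tendsto_zero _ _ _ (by omega)
    -- `(X³G)_i t^{-(g+3-i)} → [i = g+3] lc G`
    have hB : Tendsto (fun n : ℕ => (X ^ 3 * G).coeff i * ((n : ℝ) + 1) ^ 0 * (((n : ℝ) + 1)⁻¹) ^ (g + 3 - i)) atTop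
        (𝓝 (if i = g + 3 then G.leadingCoeff else 0)) := by
      rw [hXk 3]
      by_cases hi : i = g + 3
      · rw [if_pos hi, if_pos (by omega), show i - 3 = g by omega, hlcg, show g + 3 - i = 0 by omega]
        refine tendsto_const_nhds.congr fun n => ?_
        rw [pow_zero, pow_zero, mul_one, mul_one]
      · rw [if_neg hi]
        split_ifs with h3
        · by_cases hGi : G.coeff (i - 3) = 0
          · simp only [hGi, zero_mul]; exact tendsto_const_nhds
          · have := le_natDegree_of_ne_zero hGi
            exact term_tendsto_zero _ _ _ (by omega)
        · simp only [zero_mul]; exact tendsto_const_nhds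
    -- `18 (X²G)_i t^{1-(g+3-i)} → [i = g+2] 18 lc G`
    have hC : Tendsto (fun n : ℕ => 18 * (X ^ 2 * G).coeff i * ((n : ℝ) + 1) ^ 1 * (((n : ℝ) + 1)⁻¹) ^ (g + 3 - i)) atTop
        (𝓝 (if i = g + 2 then 18 * G.leadingCoeff else 0)) := by
      rw [hXk 2]
      by_cases hi : i = g + 2
      · rw [if_pos hi, if_pos (by omega), show i - 2 = g by omega, hlcg, show g + 3 - i = 1 by omega]
        exact tendsto_const_nhds.congr fun n => (term_eq _ 1 n).symm
      · rw [if_neg hi]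
        split_ifs with h2
        · by_cases hGi : G.coeff (i - 2) = 0
          · simp only [hGi, mul_zero, zero_mul]; exact tendsto_const_nhds
          · have := le_natDegree_of_ne_zero hGi
            exact term_tendsto_zero _ _ _ (by omega)
        · simp only [mul_zero, zero_mul]; exact tendsto_const_nhds
    -- `48 (XG)_i t^{2-(g+3-i)} → [i = g+1] 48 lc G`
    have hD : Tendsto (fun n : ℕ => 48 * (X * G).coeff i * ((n : ℝ) + 1) ^ 2 * (((n : ℝ) + 1)⁻¹) ^ (g + 3 - i)) atTop
        (𝓝 (if i = g + 1 then 48 * G.leadingCoeff else 0)) := by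
      have hX1 : (X * G).coeff i = if 1 ≤ i then G.coeff (i - 1) else 0 := by rw [← pow_one (X : ℝ[X]), hXk 1]
      rw [hX1]
      by_cases hi : i = g + 1
      · rw [if_pos hi, if_pos (by omega), show i - 1 = g by omega, hlcg, show g + 3 - i = 2 by omega]
        exact tendsto_const_nhds.congr fun n => (term_eq _ 2 n).symm
      · rw [if_neg hi]
        split_ifs with h1
        · by_cases hGi : G.coeff (i - 1) = 0
          · simp only [hGi, mul_zero, zero_mul]; exact tendsto_const_nhds
          · have := le_natDegree_of_ne_zero hGi
            exact term_tendsto_zero _ _ _ (by omega)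
        · simp only [mul_zero, zero_mul]; exact tendsto_const_nhds
    -- `32 G_i t^{3-(g+3-i)} → [i = g] 32 lc G`
    have hE : Tendsto (fun n : ℕ => 32 * G.coeff i * ((n : ℝ) + 1) ^ 3 * (((n : ℝ) + 1)⁻¹) ^ (g + 3 - i)) atTop
        (𝓝 (if i = g then 32 * G.leadingCoeff else 0)) := by
      by_cases hi : i = g
      · rw [if_pos hi, hi, hlcg, show g + 3 - g = 3 by omega]
        exact tendsto_const_nhds.congr fun n => (term_eq _ 3 n).symm
      · rw [if_neg hi]
        by_cases hGi : G.coeff i = 0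
        · simp only [hGi, mul_zero, zero_mul]; exact tendsto_const_nhds
        · have := le_natDegree_of_ne_zero hGi
          exact term_tendsto_zero _ _ _ (by omega)
    have hsum := (((hA.add hB).sub hC).add hD).sub hE
    rw [zero_add] at hsum
    rw [hqcoeff]
    exact hsum
  have hmem := rescaled_roots_mem Φ (g + 3) hdeg (fun n => ((n : ℝ) + 1)⁻¹) (fun _ => 1)
    (fun n => inv_ne_zero (by positivity)) (fun _ => one_ne_zero) _ hS hroots q hqdeg hq0 hcoef
  -- the root `w = 2` of `q`
  have h2 : Polynomial.aeval (2 : ℂ) q = 0 := by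
    rw [hq]; simp only [map_mul, map_sub, map_add, map_pow, Polynomial.aeval_X, Polynomial.aeval_C]; norm_num
  have := (hmem 2 h2).2
  norm_num at this

end Summit.QuantumFields.YangMills.Cruxes.RationalToGeneral.HexagonNormalForm
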